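import Summits.QuantumAdvantage.QuantumAdvantage.Theses.SupportDial
import Literature.Computability.QuantumComplexity.ShallowCircuitsRingSolutions

/-!
# ResidueDial — the CLOSED-FORM CERTIFICATE for the half-degree 𝔽₂ law (decomp-qadv lens-1, gen 7)

DECOMPOSITION CELL decomp-qadv (D-0178/D-0179), RESIDUAL MODE, BLOCKER-FIRST on the born-DRAFT
route-QuantumAdvantage-SupportDial (rev 0, commit 394ded34; closes_target F-Q1-p3): its load-bearing `p = 2`
law, item 31927 `HalfDegreeLaw2` (crux r3, SERVED), behind P1 = 31926 `NoPerfectMinority3` through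
`MinoritySelect3` (support 31928 `HalfToMinority3`).

## Finding 0 (KERNEL-CHECKED here, ACTED ON by the writer): the rev-0 item 31927 was MISSTATED
`∀ k r, 2r+3 ≤ k → SmallRingLosesDeg k r` is FALSE at `(k,r) = (3,0)` and `(4,0)`: the constant all-ones answer is
a PERFECT degree-0 strategy on the odd class of `C₃` and of `C₄` (`not_halfDegreeLaw2Rev0`, `c3_const_perfect`,
`c4_const_perfect`, by `decide`; bus NOTE 10:16:30Z).  The writer restated it 1:1 (rev 1, commit 35156d3e, item
stmt-QuantumAdvantage-32140, same decl name) with the binder `5 ≤ k` — exactly `HalfDegreeLaw2R` below; junction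
`halfDegreeLaw2_iff : SupportDial.HalfDegreeLaw2 ↔ HalfDegreeLaw2R := Iff.rfl`.  So this node's TARGET is the live
crux 32140 BY NAME, and `closes` concludes `SupportDial.HalfDegreeLaw2` itself.  (Critic PB24(2): support 31928
`HalfToMinority3 : HalfDegreeLaw2 → NoPerfectMinority3` is provable NOW with `H := univ`, the law at `k = n`; so
32140 is THE open piece under P1 = 31926.)

## The node (THE GRADED FAMILY IN `r` COLLAPSES TO THREE UNIFORM LAWS)
  `HalfDegreeLaw2R ⟸ MomentLaw2 ∧ SignTwistLaw2 ∧ YStepLaw2`   (`closes`, PROVED, 0 sorry)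
through `OddThresholdLaw2 := ∀ r ≥ 1, SmallRingLosesDeg (2r+3) r` (`oddThreshold_of_moment_signTwist`, PROVED:
sum the ring relations over the certificate set) and `halfDegreeLaw2R_of_threshold_step` (PROVED: odd sizes are
thresholds, even sizes are one Y-contraction above a threshold, smaller `r` by `lowDeg_mono`).

THE CERTIFICATE IN CLOSED FORM (answers census ask K10b of NODE-g6).  For `β ∈ {0,1}^k` let
`w_i(β) = (−1)^{β₀+⋯+βᵢ}` (prefix-parity signs) and `rot3 β := Σᵢ wᵢ(β) ∈ ℤ/3` — the ROTATION NUMBER of the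
`±1` walk (equivalently: the `𝔽₄`-multiplier of the transfer word of the COMPLEMENT pattern; the kernel walk of
`β` is `y ↦ ω·Frob^{1−βᵢ}(y)` on `𝔽₄^× ≅ ℤ/3`).  `Λ(k) := {β odd-class : rot3 β ≠ 0}`.  DATA (pure python,
`g7/exp/sigma_test.py`): `Λ(k)` EQUALS the unique GF(2)-elimination annihilator `Λ_r` of NODE-g6 at
`(k,r) = (5,1),(7,2),(9,3),(11,4)` (`|Λ| = 11, 43, 171, 683 = (2^k+1)/3`, Jacobsthal).
* `MomentLaw2` [W · ATTACKABLE · INSTRUMENTABLE]: at `k = 2r+3`, for every output `j` and every `u` of degree `≤ r`,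
  `Σ_{β ∈ Λ} Σ_{v ∈ K(β), v_j = 1} u(β) = 0` in `𝔽₂`.  PAPER PROOF ∀ r (g7 NOTES / NODE-g7.md §2): the TWO-BLOCK
  IDENTITY `1_Λ·J_j ≡ [E_j ≡ 0] + [O_j ≡ 0] (mod 2)` (`E_j`/`O_j` = the sign sums at even/odd offset from `j`;
  `TwoBlockLaw2`, `decide`d at `k = 5` below, verified `k ≤ 11`) writes `1_Λ J_j` as a sum of two functions of
  `(k−1)/2` prefix-parity coordinates each ⇒ `deg_{𝔽₂}(1_Λ J_j) ≤ (k−1)/2 = k−2−r` ⇒ Reed–Muller duality.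
  (Measured: `deg = (k−1)/2` exactly, while `deg 1_Λ = deg J_j = k−1`.)  Support `MomentOfTwoBlock2`.
* `SignTwistLaw2` [W · ATTACKABLE · INSTRUMENTABLE]: `Σ_{β ∈ Λ} Σ_{v ∈ K(β)} signBit β v = 1` in `𝔽₂`
  (`N_k := #{β ∈ Λ(k) : s(β) = 1}` is ODD for every odd `k ≥ 5`; transfer-matrix data `k ≤ 41`, `N_3 = 0` —
  which is WHY `(3,0)` fails).  PROOF PLAN: `s(β) ≡ #{i : βᵢ = 0, t_{i−1} = t_i = 2}`; reflection involution ⇒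
  `N_k ≡ M_k` = # axis-symmetric members `= J_{⌊m/2⌋}·J_{⌈m/2⌉+1}` (`m = (k−1)/2`, Jacobsthal PRODUCT, data
  `m ≤ 11`), odd; fallback: 36-state automaton, `M^k mod 2` periodic (`decide`).
* `YStepLaw2` [W · ATTACKABLE]: `SmallRingLosesDeg k r → SmallRingLosesDeg (k+1) r` (`r ≥ 1`) — the EXACT
  Y-CONTRACTION `Rel_{k+1}(β,z) ⟺ Rel_k(β′,z′)` for `β_v = 1` (`β′` = delete `v`, complement both neighbours;
  `z′_u = z_u+z_v+β′_u`, `z′_w = z_w+z_v+β′_w`), verified exhaustively on rings `4..8` (`g7/exp/ycontract.py`,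
  43 648 pairs); graph-state `Y`-measurement rule = local complementation.  Makes EVEN sizes follow from odd.
WHY EACH PIECE IS STRICTLY WEAKER: `MomentLaw2` says nothing about sign bits (holds at `k = 3` where the law
fails); `SignTwistLaw2` says nothing about strategies/degrees; `YStepLaw2` is an implication between ring sizes
(vacuous without a seed); none implies `HalfDegreeLaw2R` alone (bc probes `g7/bc/`), all three are consequences of
the elementary walk calculus and are NECESSARY in the sense that they hold (data) — no residual at `p = 2`.
WHY THIS IS NOVEL: the annihilator of the half-degree system is the MOD-3 ROTATION NUMBER of the prefix-parity
walk — a parity-twisted additive `ℤ/3` statistic (cf. lens-2 MotifDial's IDEA-NEEDED seam `sigmaSum` at `p = 3`)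
— and its product with every kernel coordinate splits into two half-juntas; no such closed form is in NODE-g0..g6,
the tree, or the literature searched (BGK18/WKST19/BGKT20/Grier–Schaeffer use light-cone/parity arguments at
fan-in `< √n`, never a degree certificate).
ONE language change only (sums over all kernel vectors instead of "the" kernel line: for odd-class `β`,
`K(β) = {0, J(β)}`), no EQUIV layer; `closes` 0 sorry; target junctions `halfDegreeLaw2_iff := Iff.rfl`.
-/

set_option linter.dupNamespace false
set_option linter.style.longLine false
set_option linter.unusedVariables false

open Finset
open Literature.Computability.QuantumComplexity.RingHLF
open Literature.Computability.MetaComplexity.Smolensky (CubeFn mono lowDeg)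
open Summit.QuantumAdvantage.AdviceFreeQNC0

namespace Summit.QuantumAdvantage.QuantumAdvantage.Theorems.SupportDialResidueCertificate

/-! ## §1 The target: the repaired half-degree law -/

/-- **`SmallRingLosesDeg k r`** (verbatim body of 31927): on the bare `k`-cycle every strategy all of whose output
coordinates are `𝔽₂`-polynomials of degree `≤ r` in the input loses some odd-class input. -/
def SmallRingLosesDeg (k r : ℕ) : Prop :=
  ∀ w : (Fin k → Bool) → Fin k → Bool,
    (∀ j : Fin k, (fun β : Fin k → Bool => if w β j = true then (1 : ZMod 2) else 0) ∈ lowDeg (ZMod 2) k r) →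
      ∃ β : Fin k → Bool, OddZeros β ∧ ¬ Rel β (w β)

/-- The rev-0 text of item 31927 (no size guard) — REFUTED in §5; kept as the settled negative edge. -/
def HalfDegreeLaw2Rev0 : Prop := ∀ k r : ℕ, 2 * r + 3 ≤ k → SmallRingLosesDeg k r

/-- **TARGET `HalfDegreeLaw2R`** [target = tree item stmt-QuantumAdvantage-32140 `SupportDial.HalfDegreeLaw2` rev 1 BY
NAME, junction `halfDegreeLaw2_iff := Iff.rfl`]: for ring sizes `k ≥ 5`, perfect odd-class play on the bare
`k`-cycle needs `𝔽₂`-degree `> (k−3)/2`. [conjecture ∀ k; data k ≤ 13 both directions (NODE-g6, writer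
hdl2_check.py); this node reduces it to three uniform walk laws] -/
def HalfDegreeLaw2R : Prop := ∀ k r : ℕ, 5 ≤ k → 2 * r + 3 ≤ k → SmallRingLosesDeg k r

/-- **Junction (definitional):** the tree item 32140 `SupportDial.HalfDegreeLaw2` (rev 1, commit 35156d3e, restated
with the `5 ≤ k` binder after this seat's refutation of rev 0) IS `HalfDegreeLaw2R`. -/
theorem halfDegreeLaw2_iff :
    Summit.QuantumAdvantage.QuantumAdvantage.Theses.SupportDial.HalfDegreeLaw2 ↔ HalfDegreeLaw2R := Iff.rfl

/-- The rev-0 statement implies the guarded one (and is false, §5: the guard is exactly what it lacked). -/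
theorem halfDegreeLaw2R_of_rev0 (h : HalfDegreeLaw2Rev0) : HalfDegreeLaw2R := fun k r _ hk => h k r hk

/-- ResidueDial helper `smallRingLosesDeg_mono` (lens-1 g7 ResidueDial certificate; see the enclosing section docstring). -/
theorem smallRingLosesDeg_mono {k r r' : ℕ} (h : r' ≤ r) (hk : SmallRingLosesDeg k r) :
    SmallRingLosesDeg k r' :=
  fun w hw => hk w fun j => Literature.Computability.MetaComplexity.Smolensky.lowDeg_mono h (hw j)

/-! ## §2 The closed-form certificate: rotation number of the prefix-parity walk -/

/-- Indicator of a Boolean in `𝔽₂`. -/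
def ind (b : Bool) : ZMod 2 := if b = true then 1 else 0

/-- ResidueDial helper `ind_true` (lens-1 g7 ResidueDial certificate; see the enclosing section docstring). -/
@[simp] theorem ind_true : ind true = 1 := rfl
/-- ResidueDial helper `ind_false` (lens-1 g7 ResidueDial certificate; see the enclosing section docstring). -/
@[simp] theorem ind_false : ind false = 0 := rfl
/-- ResidueDial helper `ind_and` (lens-1 g7 ResidueDial certificate; see the enclosing section docstring). -/
theorem ind_and (a b : Bool) : ind (a && b) = ind a * ind b := by cases a <;> cases b <;> rfl

/-- Odd class as a Boolean (`= OddZeros`, kept computable for `decide`). -/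
def oddZ {k : ℕ} (β : Fin k → Bool) : Bool := decide ((univ.filter fun b : Fin k => β b = false).card % 2 = 1)

/-- ResidueDial helper `oddZ_iff` (lens-1 g7 ResidueDial certificate; see the enclosing section docstring). -/
theorem oddZ_iff {k : ℕ} (β : Fin k → Bool) : oddZ β = true ↔ OddZeros β := by
  unfold oddZ OddZeros; exact decide_eq_true_iff

/-- **`rot3 β ∈ ℤ/3`**: the rotation number `Σᵢ (−1)^{β₀+⋯+βᵢ}` of the prefix-parity `±1` walk of `β`. [NEW object] -/
def rot3 {k : ℕ} (β : Fin k → Bool) : ZMod 3 :=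
  ∑ i : Fin k, (-1 : ZMod 3) ^ (univ.filter fun j : Fin k => j ≤ i ∧ β j = true).card

/-- **The certificate set `Λ(k)`** as a Boolean: odd class and non-zero rotation number. -/
def lamB {k : ℕ} (β : Fin k → Bool) : Bool := oddZ β && decide (rot3 β ≠ 0)

/-- Kernel membership as a Boolean (`InKernel` is decidable in the tree). -/
def kerB {k : ℕ} (β v : Fin k → Bool) : Bool := decide (InKernel β v)

/-- ResidueDial helper `oddZeros_of_lamB` (lens-1 g7 ResidueDial certificate; see the enclosing section docstring). -/
theorem oddZeros_of_lamB {k : ℕ} {β : Fin k → Bool} (h : lamB β = true) : OddZeros β := by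
  unfold lamB at h; rw [Bool.and_eq_true] at h; exact (oddZ_iff β).1 h.1

/-- ResidueDial helper `inKernel_of_kerB` (lens-1 g7 ResidueDial certificate; see the enclosing section docstring). -/
theorem inKernel_of_kerB {k : ℕ} {β v : Fin k → Bool} (h : kerB β v = true) : InKernel β v := by
  unfold kerB at h; exact of_decide_eq_true h

/-! ## §3 The three pieces -/

/-- **PIECE `MomentLaw2`** [crux, rank 2 · WEAKER · ATTACKABLE (two-block identity ⇒ RM duality, paper proof ∀ r) ·
INSTRUMENTABLE (`decide` per `k`; = census K10b closed form, verified k ≤ 11)]: at the threshold `k = 2r+3` the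
certificate `Λ(k)` annihilates every column `J_j · u`, `deg u ≤ r`:
`Σ_β Σ_v [β ∈ Λ ∧ v ∈ K(β) ∧ v_j = 1] · u(β) = 0` in `𝔽₂`.
WHY IT MIGHT FAIL: only if the closed form `Λ = {rot3 ≠ 0}` stops being the annihilator at some `r ≥ 5`
(data to `r = 4`; the paper proof is uniform in `r`).  SOURCES: NODE-g6 §K10 tables; BravyiGossetKonigScience2018 Eq. (2). -/
def MomentLaw2 : Prop :=
  ∀ r : ℕ, 1 ≤ r → ∀ j : Fin (2 * r + 3), ∀ u : CubeFn (ZMod 2) (2 * r + 3), u ∈ lowDeg (ZMod 2) (2 * r + 3) r →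
    (∑ β : Fin (2 * r + 3) → Bool, ∑ v : Fin (2 * r + 3) → Bool, ind (lamB β && kerB β v && v j) * u β) = 0

/-- **PIECE `SignTwistLaw2`** [crux, rank 3 · WEAKER · ATTACKABLE (reflection involution + Jacobsthal product
`M_k = J_{⌊m/2⌋} J_{⌈m/2⌉+1}`; fallback 36-state automaton periodicity) · INSTRUMENTABLE (transfer matrix, data
k ≤ 41)]: the certificate pairs ODDLY with the sign bits: `Σ_β Σ_v [β ∈ Λ ∧ v ∈ K(β)] · signBit β v = 1` in `𝔽₂`
at every threshold size `k = 2r+3`, `r ≥ 1`.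
WHY IT MIGHT FAIL: it does fail at `k = 3` (`N_3 = 0`) — the parity could in principle flip again at large `k`
(data says constant to `k = 41`; a linear recurrence mod 2 is eventually periodic, so finitely many checks decide
it once the automaton is formalised).  SOURCES: g7/exp/count_S.py, symm_count.py; BravyiGossetKonigScience2018 Eq. (1)–(2). -/
def SignTwistLaw2 : Prop :=
  ∀ r : ℕ, 1 ≤ r →
    (∑ β : Fin (2 * r + 3) → Bool, ∑ v : Fin (2 * r + 3) → Bool,
        ind (lamB β && kerB β v) * ((signBit β v : ℕ) : ZMod 2)) = 1

/-- **PIECE `YStepLaw2`** [crux, rank 4 · WEAKER · ATTACKABLE (exact Y-contraction law, verified exhaustively on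
rings 4..8; = graph-state local complementation at a `Y`-measured vertex)]: losing degree-`r` play on `C_k` forces
losing degree-`r` play on `C_{k+1}` (`r ≥ 1`: the contraction shifts two outputs by an input bit).
WHY IT MIGHT FAIL: only through an index slip in the contraction (`z′_u = z_u + z_v + β′_u`); the identity is
exact for ALL `β` with `β_v = 1`, both classes.  SOURCES: g7/exp/ycontract.py; HeinEisertBriegel2004 (LC rule), BGK18. -/
def YStepLaw2 : Prop := ∀ k r : ℕ, 3 ≤ k → 1 ≤ r → SmallRingLosesDeg k r → SmallRingLosesDeg (k + 1) r

/-- **`OddThresholdLaw2`** (intermediate, PROVED from `MomentLaw2 ∧ SignTwistLaw2` below): the law at every odd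
threshold `(2r+3, r)`, `r ≥ 1`. -/
def OddThresholdLaw2 : Prop := ∀ r : ℕ, 1 ≤ r → SmallRingLosesDeg (2 * r + 3) r

/-! ## §4 Glue (PROVED) -/

/-- `dot2 v z` in `𝔽₂` is the sum of the coordinate products. -/
theorem dot2_cast {k : ℕ} (v z : Fin k → Bool) :
    ((dot2 v z : ℕ) : ZMod 2) = ∑ b : Fin k, ind (v b && z b) := by
  unfold dot2
  rw [ZMod.natCast_mod, Finset.natCast_card_filter]
  refine Finset.sum_congr rfl fun b _ => ?_
  unfold ind
  cases v b <;> cases z b <;> simp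

/-- The moment law AT ONE GRADE `r` (all columns of the threshold ring `C_{2r+3}` annihilated by `Λ`). -/
def MomentAt (r : ℕ) : Prop :=
  ∀ j : Fin (2 * r + 3), ∀ u : CubeFn (ZMod 2) (2 * r + 3), u ∈ lowDeg (ZMod 2) (2 * r + 3) r →
    (∑ β : Fin (2 * r + 3) → Bool, ∑ v : Fin (2 * r + 3) → Bool, ind (lamB β && kerB β v && v j) * u β) = 0

/-- The sign twist AT ONE GRADE `r`. -/
def SignTwistAt (r : ℕ) : Prop :=
  (∑ β : Fin (2 * r + 3) → Bool, ∑ v : Fin (2 * r + 3) → Bool,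
      ind (lamB β && kerB β v) * ((signBit β v : ℕ) : ZMod 2)) = 1

/-- ResidueDial helper `momentLaw2_iff` (lens-1 g7 ResidueDial certificate; see the enclosing section docstring). -/
theorem momentLaw2_iff : MomentLaw2 ↔ ∀ r, 1 ≤ r → MomentAt r := Iff.rfl
/-- ResidueDial helper `signTwistLaw2_iff` (lens-1 g7 ResidueDial certificate; see the enclosing section docstring). -/
theorem signTwistLaw2_iff : SignTwistLaw2 ↔ ∀ r, 1 ≤ r → SignTwistAt r := Iff.rfl

/-- **CERTIFICATE SOUNDNESS AT GRADE `r` (PROVED).**  `MomentAt r → SignTwistAt r → SmallRingLosesDeg (2r+3) r`: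
if a degree-`≤ r` strategy were perfect on the odd class of `C_{2r+3}`, summing its ring relations
`⟨v, w(β)⟩ = signBit β v` over `β ∈ Λ`, `v ∈ K(β)` gives `1` (sign twist) on one side and, after exchanging the
sums, a sum over outputs `j` of annihilated columns (`= 0`, moment law) on the other. -/
theorem smallRingLosesDeg_of_certificate (r : ℕ) (hM : MomentAt r) (hS : SignTwistAt r) :
    SmallRingLosesDeg (2 * r + 3) r := by
  intro w hw
  by_contra hcon
  have hperf : ∀ β : Fin (2 * r + 3) → Bool, OddZeros β → Rel β (w β) := fun β hβ => by
    by_contra hn; exact hcon ⟨β, hβ, hn⟩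
  have hS' : (∑ β : Fin (2 * r + 3) → Bool, ∑ v : Fin (2 * r + 3) → Bool,
      ind (lamB β && kerB β v) * ((signBit β v : ℕ) : ZMod 2)) = 1 := hS
  -- the summand after expanding the dot product coordinate-wise
  set F : (Fin (2 * r + 3) → Bool) → (Fin (2 * r + 3) → Bool) → Fin (2 * r + 3) → ZMod 2 :=
    fun β v j => ind (lamB β && kerB β v && v j) * (if w β j = true then (1 : ZMod 2) else 0) with hF
  -- rewrite every sign bit of a certified pair through the (assumed perfect) ring relation and expand `dot2`
  have step1 : ∀ β v : Fin (2 * r + 3) → Bool,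
      ind (lamB β && kerB β v) * ((signBit β v : ℕ) : ZMod 2) = ∑ j : Fin (2 * r + 3), F β v j := by
    intro β v
    by_cases hc : (lamB β && kerB β v) = true
    · have hc' := hc
      rw [Bool.and_eq_true] at hc'
      have hrel : Rel β (w β) := hperf β (oddZeros_of_lamB hc'.1)
      rw [← hrel v (inKernel_of_kerB hc'.2), dot2_cast, Finset.mul_sum]
      refine Finset.sum_congr rfl fun j _ => ?_
      rw [hF]
      dsimp only
      rw [ind_and (lamB β && kerB β v) (v j), ind_and (v j) (w β j), mul_assoc]
      rfl
    · rw [Bool.not_eq_true] at hc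
      have h0 : ∀ j : Fin (2 * r + 3), F β v j = 0 := by
        intro j; rw [hF]; dsimp only; rw [hc]; simp [ind]
      rw [hc, Finset.sum_congr rfl fun j _ => h0 j]; simp [ind]
  have step2 : (∑ β : Fin (2 * r + 3) → Bool, ∑ v : Fin (2 * r + 3) → Bool,
        ind (lamB β && kerB β v) * ((signBit β v : ℕ) : ZMod 2))
      = ∑ j : Fin (2 * r + 3), ∑ β : Fin (2 * r + 3) → Bool, ∑ v : Fin (2 * r + 3) → Bool, F β v j := by
    calc (∑ β : Fin (2 * r + 3) → Bool, ∑ v : Fin (2 * r + 3) → Bool,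
            ind (lamB β && kerB β v) * ((signBit β v : ℕ) : ZMod 2))
        = ∑ β : Fin (2 * r + 3) → Bool, ∑ v : Fin (2 * r + 3) → Bool, ∑ j : Fin (2 * r + 3), F β v j :=
          Finset.sum_congr rfl fun β _ => Finset.sum_congr rfl fun v _ => step1 β v
      _ = ∑ β : Fin (2 * r + 3) → Bool, ∑ j : Fin (2 * r + 3), ∑ v : Fin (2 * r + 3) → Bool, F β v j :=
          Finset.sum_congr rfl fun β _ => Finset.sum_comm
      _ = ∑ j : Fin (2 * r + 3), ∑ β : Fin (2 * r + 3) → Bool, ∑ v : Fin (2 * r + 3) → Bool, F β v j :=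
          Finset.sum_comm
  -- each column is annihilated (moment law)
  have step3 : (∑ j : Fin (2 * r + 3), ∑ β : Fin (2 * r + 3) → Bool, ∑ v : Fin (2 * r + 3) → Bool, F β v j) = 0 := by
    refine Finset.sum_eq_zero fun j _ => ?_
    have := hM j (fun β => if w β j = true then (1 : ZMod 2) else 0) (hw j)
    rw [hF]
    exact this
  rw [step2, step3] at hS'
  exact zero_ne_one hS'

/-- **CERTIFICATE SOUNDNESS (PROVED).**  `MomentLaw2 → SignTwistLaw2 → OddThresholdLaw2`. -/
theorem oddThreshold_of_moment_signTwist (hM : MomentLaw2) (hS : SignTwistLaw2) : OddThresholdLaw2 :=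
  fun r hr => smallRingLosesDeg_of_certificate r (hM r hr) (hS r hr)

/-- **SIZE BOOKKEEPING (PROVED).**  `OddThresholdLaw2 → YStepLaw2 → HalfDegreeLaw2R`: an odd size `k ≥ 5` IS the
threshold `2·((k−3)/2)+3`; an even size `k ≥ 6` is one Y-contraction above the threshold `k−1`; smaller degrees by
monotonicity of `lowDeg`. -/
theorem halfDegreeLaw2R_of_threshold_step (hO : OddThresholdLaw2) (hY : YStepLaw2) : HalfDegreeLaw2R := by
  intro k r h5 hk
  obtain ⟨m, hm | hm⟩ := Nat.even_or_odd' k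
  · -- even k = 2m, m ≥ 3 : threshold at k - 1 = 2(m-2)+3 with degree m-2, then one Y-step
    have hm3 : 3 ≤ m := by omega
    have hth : SmallRingLosesDeg (2 * (m - 2) + 3) (m - 2) := hO (m - 2) (by omega)
    have hstep : SmallRingLosesDeg (2 * (m - 2) + 3 + 1) (m - 2) := hY _ _ (by omega) (by omega) hth
    have hk' : 2 * (m - 2) + 3 + 1 = k := by omega
    rw [hk'] at hstep
    exact smallRingLosesDeg_mono (by omega) hstep
  · -- odd k = 2m+1, m ≥ 2 : k is the threshold of degree m-1
    have hm2 : 2 ≤ m := by omega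
    have hth : SmallRingLosesDeg (2 * (m - 1) + 3) (m - 1) := hO (m - 1) (by omega)
    have hk' : 2 * (m - 1) + 3 = k := by omega
    rw [hk'] at hth
    exact smallRingLosesDeg_mono (by omega) hth

/-- `closes_R`: the node onto the local name. -/
theorem closes_R (hM : MomentLaw2) (hS : SignTwistLaw2) (hY : YStepLaw2) : HalfDegreeLaw2R :=
  halfDegreeLaw2R_of_threshold_step (oddThreshold_of_moment_signTwist hM hS) hY

/-- **`closes` — THE NODE (PROVED, 0 sorry), concluding the TREE ITEM 32140 BY NAME:**
`MomentLaw2 → SignTwistLaw2 → YStepLaw2 → SupportDial.HalfDegreeLaw2`. -/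
theorem closes (hM : MomentLaw2) (hS : SignTwistLaw2) (hY : YStepLaw2) :
    Summit.QuantumAdvantage.QuantumAdvantage.Theses.SupportDial.HalfDegreeLaw2 :=
  halfDegreeLaw2_iff.mpr (closes_R hM hS hY)

/-- Optional assembly item (same content as `closes`). -/
def Assembly : Prop :=
  MomentLaw2 → SignTwistLaw2 → YStepLaw2 → Summit.QuantumAdvantage.QuantumAdvantage.Theses.SupportDial.HalfDegreeLaw2

/-- ResidueDial helper `assembly_holds` (lens-1 g7 ResidueDial certificate; see the enclosing section docstring). -/
theorem assembly_holds : Assembly := closes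

/-! ## §5 The rev-0 item 31927 (no size guard) is FALSE (kernel-checked): the `r = 0`, `k ∈ {3,4}` corner
(bus NOTE 10:16:30Z; writer ROUTE-EDIT rev 1 10:29:51Z restated it as 32140 with `5 ≤ k`; critic PB25 CLOSED) -/

set_option maxRecDepth 100000 in
/-- On `C₃` the constant all-ones answer is valid for EVERY odd-class pattern. -/
theorem c3_const_perfect : ∀ β : Fin 3 → Bool, OddZeros β → Rel β (fun _ => true) := by
  unfold OddZeros; decide

set_option maxRecDepth 100000 in
/-- On `C₄` likewise. -/
theorem c4_const_perfect : ∀ β : Fin 4 → Bool, OddZeros β → Rel β (fun _ => true) := by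
  unfold OddZeros; decide

/-- The constant strategy has degree `0`. -/
theorem const_mem_lowDeg_zero (k : ℕ) (j : Fin k) :
    (fun β : Fin k → Bool => if ((fun _ _ => true : (Fin k → Bool) → Fin k → Bool) β j) = true
        then (1 : ZMod 2) else 0) ∈ lowDeg (ZMod 2) k 0 := by
  have : (fun β : Fin k → Bool => if ((fun _ _ => true : (Fin k → Bool) → Fin k → Bool) β j) = true
      then (1 : ZMod 2) else 0) = mono (ZMod 2) (∅ : Finset (Fin k)) := by
    funext b; simp
  rw [this]
  exact Literature.Computability.MetaComplexity.Smolensky.mono_mem_lowDeg (by simp)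

/-- `¬ SmallRingLosesDeg 3 0`. -/
theorem not_smallRingLosesDeg_3_0 : ¬ SmallRingLosesDeg 3 0 := by
  intro h
  obtain ⟨β, hβ, hrel⟩ := h (fun _ _ => true) (const_mem_lowDeg_zero 3)
  exact hrel (c3_const_perfect β hβ)

/-- `¬ SmallRingLosesDeg 4 0`. -/
theorem not_smallRingLosesDeg_4_0 : ¬ SmallRingLosesDeg 4 0 := by
  intro h
  obtain ⟨β, hβ, hrel⟩ := h (fun _ _ => true) (const_mem_lowDeg_zero 4)
  exact hrel (c4_const_perfect β hβ)

/-- **REFUTATION of the rev-0 item 31927** (`class: misstated`; repaired statement = `HalfDegreeLaw2R` = tree rev 1):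
`¬ HalfDegreeLaw2Rev0`, instance `(k,r) = (3,0)`. -/
theorem not_halfDegreeLaw2Rev0 : ¬ HalfDegreeLaw2Rev0 :=
  fun h => not_smallRingLosesDeg_3_0 (h 3 0 (by norm_num))

/-- The size guard is SHARP at the bottom: the target's first grade `k = 5` is a theorem (§7), `k = 3, 4` fail. -/
theorem guard_sharp : ¬ SmallRingLosesDeg 3 0 ∧ ¬ SmallRingLosesDeg 4 0 := ⟨not_smallRingLosesDeg_3_0, not_smallRingLosesDeg_4_0⟩

/-! ## §6 The two-block identity (the REASON behind `MomentLaw2`) and the typed support -/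

/-- Parity count of `β` on the cyclic interval `[j, j+d]` = `{l : (l − j) mod k ≤ d}` (via `Fin` subtraction; for
`d ≥ k−1` it is the total number of ones). -/
def psum {k : ℕ} (β : Fin k → Bool) (j : Fin k) (d : ℕ) : ℕ :=
  (univ.filter fun l : Fin k => (l - j).val ≤ d ∧ β l = true).card

/-- Block sum `Σ_{d ≡ par (2), d < k} (−1)^{β_j+⋯+β_{j+d}} ∈ ℤ/3` — `par = 0`: `E_j` (`(k+1)/2` signs), `par = 1`: `O_j`
(`(k−1)/2` signs).  On the odd class each is a function of `≤ (k−1)/2` prefix-parity coordinates. [NEW objects] -/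
def blk {k : ℕ} (β : Fin k → Bool) (j : Fin k) (par : ℕ) : ZMod 3 :=
  ∑ d ∈ (Finset.range k).filter (fun d => d % 2 = par), (-1 : ZMod 3) ^ psum β j d

/-- `J_j(β)` as a Boolean: the parity of the number of kernel vectors `v ∈ K(β)` with `v_j = 1` (on the odd class
`K(β) = {0, J(β)}` is a line, so this IS the `j`-th coordinate of the kernel line). -/
def jB {k : ℕ} (β : Fin k → Bool) (j : Fin k) : Bool :=
  decide ((univ.filter fun v : Fin k → Bool => InKernel β v ∧ v j = true).card % 2 = 1)

/-- **`TwoBlockLaw2`** [support · PROVED in §6c (`twoBlockLaw2`) for every odd `k ≥ 3` (𝔽₃ algebra: `J_j = [E_j − O_j ≢ 0]`,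
`1_Λ = [E_j + O_j ≢ 0]`, so `1_Λ J_j = [E_j² ≠ O_j²] = [E_j ≡ 0] + [O_j ≡ 0] (mod 2)`; also `decide`d at k = 5, 7:
`twoBlock_five`, `twoBlock_seven`)]: for odd `k ≥ 3` and odd-class `β`,
`[rot3 β ≠ 0] · J_j(β) = [E_j(β) ≡ 0] ⊕ [O_j(β) ≡ 0]`. -/
def TwoBlockLaw2 : Prop :=
  ∀ k : ℕ, 3 ≤ k → k % 2 = 1 → ∀ β : Fin k → Bool, oddZ β = true → ∀ j : Fin k,
    (decide (rot3 β ≠ 0) && jB β j) = xor (decide (blk β j 0 = 0)) (decide (blk β j 1 = 0))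

/-- **`MomentOfTwoBlock2`** [support · PROVED in §6b (`momentOfTwoBlock2`)]: the two-block identity implies the moment law —
each block indicator is a function of `≤ (k−1)/2 = k−2−r` of the `k−1` prefix-parity coordinates of the odd class,
hence of `𝔽₂`-degree `≤ k−2−r`, so its product with a degree-`≤ r` column sums to `0` over the odd class
(Reed–Muller duality; tree `LowDegOrth.sum_eq_zero_of_mem_lowDeg`). -/
def MomentOfTwoBlock2 : Prop := TwoBlockLaw2 → MomentLaw2

end Summit.QuantumAdvantage.QuantumAdvantage.Theorems.SupportDialResidueCertificate
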